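import Mathlib
import Summits.NavierStokesRegularity.NavierStokesRegularity.Theorems.EulerZoomLiouvillePowerGaugeEulerLiouvilleSelfSimilarSourceNode
import HarnessLib

/-!
# Rung C1 of the crux `EulerZoomLiouville.PowerGaugeEulerLiouville`: vorticity vanishes near every stagnation point
# at which the linearised similarity flow is a REAL-DIAGONALISABLE SOURCE — unconditionally in the window `γ < ½`
# (route №10, item stmt-NavierStokesRegularity-19832; `--supports`)

Helper file (theorems only). Seat ns-typeII-p3 (cell ns-regularity-ideate §B, D-0081).  Part (L), real-diagonalisable
case, of the crux idea «hyperbolic-stagnation exclusion» (evidence #41 on the item): the linear algebra that feeds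
`…SelfSimilarSourceNode.curl_eq_zero_near_adaptedSourceNode`.

* `exists_adapted_of_eigenbasis` — if a linear map `A` of `ℝ³` has a basis of eigenvectors with real eigenvalues in
  `[μ₀, Λ₀]`, then the pull-back `G = RᵀR` of the Euclidean structure by the coordinate map `R` is an adapted inner
  product: `G` symmetric, `⟪Gh,h⟫ ≥ g₀‖h‖²`, `μ₀⟪Gh,h⟫ ≤ ⟪G A h, h⟫ ≤ Λ₀⟪Gh,h⟫`;
* `sum_eigenvalues_eq_three_mul` — for `A = DW(y*) = γI + DV(y*)` with `div V = 0`: the eigenvalues sum to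
  `tr DW(y*) = 3γ`;
* `curl_eq_zero_near_diagonalisableSource` — **THE UNCONDITIONAL NODE THEOREM (real-diagonalisable sources)**: let
  `(V, P)` be a classical self-similar profile with `0 < γ < ½`, `y*` a zero of `W = γy + V` such that `DW(y*)` has
  a basis of eigenvectors with POSITIVE real eigenvalues.  Then `curl V ≡ 0` on a neighbourhood of `y*`.
  (Positivity and `Σλᵢ = 3γ` give `λᵢ < 3γ < 1 + γ`: the window is exactly what makes every source too weak to
  sustain the self-similar vorticity amplification `e^{(1+γ)|s|}` along incoming trajectories.)

The complex-eigenvalue (spiral) sources need the Lyapunov adapted metric (integral construction) — not in this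
file; the measure-theoretic global step (KEEP-2) neither.  WHAT THIS IS NOT: not NS, not E, not rung C1.
[folklore; cf. ConstantinIgnatovaVicol2026Putative §3.5 Thm 3.8 (node with `Ω ≠ 0`), Rem. 3.6]
-/

noncomputable section

-- flat `Theorems/<Route><Decl>…` files of one crux share the namespace of the crux (tree convention)
set_option linter.dupNamespace false

open MeasureTheory Set Filter Topology Metric Function InnerProductSpace
open scoped RealInnerProductSpace NNReal ContDiff

namespace Summit.NavierStokesRegularity.NavierStokesRegularity.Theorems.PowerGaugeEulerLiouville.Kelvin

open Literature.Analysis Literature.Analysis.FluidPDE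

variable {γ : ℝ} {V : EuclideanSpace ℝ (Fin 3) → EuclideanSpace ℝ (Fin 3)} {P : EuclideanSpace ℝ (Fin 3) → ℝ}

/-! ### Adapted inner product from a real eigenbasis -/

/-- **Adapted inner product from an eigenbasis.**  Let `A : ℝ³ →L ℝ³` and `b` a basis with `A (b i) = λ i • b i`
and `μ₀ ≤ λ i ≤ Λ₀`.  With `R` the coordinate map of `b` (valued in Euclidean `ℝ³`) and `G = R† ∘ R`:
`G` is symmetric, `⟪Gh,h⟫ = ‖Rh‖² ≥ g₀‖h‖²` for some `g₀ > 0`, and `μ₀⟪Gh,h⟫ ≤ ⟪G A h, h⟫ ≤ Λ₀⟪Gh,h⟫`.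
[folklore] -/
theorem exists_adapted_of_eigenbasis (A : EuclideanSpace ℝ (Fin 3) →L[ℝ] EuclideanSpace ℝ (Fin 3))
    (b : Module.Basis (Fin 3) ℝ (EuclideanSpace ℝ (Fin 3))) (lam : Fin 3 → ℝ) (hA : ∀ i, A (b i) = lam i • b i)
    {μ₀ Λ₀ : ℝ} (hlo : ∀ i, μ₀ ≤ lam i) (hhi : ∀ i, lam i ≤ Λ₀) :
    ∃ G : EuclideanSpace ℝ (Fin 3) →L[ℝ] EuclideanSpace ℝ (Fin 3),
      (∀ u v : EuclideanSpace ℝ (Fin 3), ⟪G u, v⟫ = ⟪u, G v⟫) ∧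
      (∃ g₀ : ℝ, 0 < g₀ ∧ ∀ h : EuclideanSpace ℝ (Fin 3), g₀ * ‖h‖ ^ 2 ≤ ⟪G h, h⟫) ∧
      (∀ h : EuclideanSpace ℝ (Fin 3), μ₀ * ⟪G h, h⟫ ≤ ⟪G (A h), h⟫ ∧ ⟪G (A h), h⟫ ≤ Λ₀ * ⟪G h, h⟫) := by
  -- the coordinate map `R h = (b.repr h)` as a vector of Euclidean `ℝ³`
  let Rl : EuclideanSpace ℝ (Fin 3) →ₗ[ℝ] EuclideanSpace ℝ (Fin 3) :=
    (WithLp.linearEquiv 2 ℝ (Fin 3 → ℝ)).symm.toLinearMap ∘ₗ b.equivFun.toLinearMap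
  let R : EuclideanSpace ℝ (Fin 3) →L[ℝ] EuclideanSpace ℝ (Fin 3) := LinearMap.toContinuousLinearMap Rl
  have hRapp : ∀ h : EuclideanSpace ℝ (Fin 3), ∀ i, R h i = b.repr h i := fun h i => rfl
  -- coordinates of `A h`: `(R (A h)) i = λ i * (R h) i`
  have hRA : ∀ h : EuclideanSpace ℝ (Fin 3), ∀ i, R (A h) i = lam i * R h i := by
    intro h i
    -- both sides are linear in `h`; check on the basis
    have key : ∀ j, b.repr (A (b j)) i = lam i * b.repr (b j) i := by
      intro j
      rw [hA j, map_smul, Finsupp.smul_apply, smul_eq_mul, b.repr_self]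
      by_cases hij : j = i
      · subst hij; simp
      · rw [Finsupp.single_apply, if_neg hij, mul_zero, mul_zero]
    -- direct expansion in the basis
    have hexp : h = ∑ j, b.repr h j • b j := (b.sum_repr h).symm
    rw [hRapp, hRapp]
    conv_lhs => rw [hexp]
    rw [map_sum, map_sum]
    simp only [map_smul, Finsupp.coe_finsetSum, Finsupp.coe_smul, Finset.sum_apply, Pi.smul_apply,
      smul_eq_mul, key]
    rw [Finset.sum_eq_single i]
    · rw [b.repr_self, Finsupp.single_eq_same]; ring
    · intro x _ hx
      rw [b.repr_self, Finsupp.single_apply, if_neg hx]; ring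
    · intro hi; exact absurd (Finset.mem_univ i) hi
  -- `G = R† R`
  refine ⟨(ContinuousLinearMap.adjoint R).comp R, fun u v => ?_, ?_, fun h => ?_⟩
  · rw [ContinuousLinearMap.comp_apply, ContinuousLinearMap.comp_apply,
      ContinuousLinearMap.adjoint_inner_left, ← ContinuousLinearMap.adjoint_inner_right]
  · -- positivity: `‖h‖ ≤ C ‖R h‖` with `C = ‖R⁻¹‖`
    let Rinv : EuclideanSpace ℝ (Fin 3) →L[ℝ] EuclideanSpace ℝ (Fin 3) :=
      LinearMap.toContinuousLinearMap (b.equivFun.symm.toLinearMap ∘ₗ (WithLp.linearEquiv 2 ℝ (Fin 3 → ℝ)).toLinearMap)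
    have hinv : ∀ h, Rinv (R h) = h := by
      intro h
      show b.equivFun.symm ((WithLp.linearEquiv 2 ℝ (Fin 3 → ℝ)) ((WithLp.linearEquiv 2 ℝ (Fin 3 → ℝ)).symm
        (b.equivFun h))) = h
      rw [LinearEquiv.apply_symm_apply, LinearEquiv.symm_apply_apply]
    refine ⟨1 / (‖Rinv‖ ^ 2 + 1), by positivity, fun h => ?_⟩
    rw [ContinuousLinearMap.comp_apply, ContinuousLinearMap.adjoint_inner_left, real_inner_self_eq_norm_sq]
    have h1 : ‖h‖ ≤ ‖Rinv‖ * ‖R h‖ := by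
      calc ‖h‖ = ‖Rinv (R h)‖ := by rw [hinv]
        _ ≤ ‖Rinv‖ * ‖R h‖ := Rinv.le_opNorm _
    have h2 : ‖h‖ ^ 2 ≤ ‖Rinv‖ ^ 2 * ‖R h‖ ^ 2 := by
      rw [← mul_pow]; exact pow_le_pow_left₀ (norm_nonneg _) h1 2
    have hpos : 0 < ‖Rinv‖ ^ 2 + 1 := by positivity
    rw [div_mul_eq_mul_div, one_mul, div_le_iff₀ hpos]
    nlinarith [sq_nonneg ‖R h‖, norm_nonneg (R h)]
  · -- the pinching: `⟪G A h, h⟫ = Σ λᵢ (Rh)ᵢ²`, `⟪G h, h⟫ = Σ (Rh)ᵢ²`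
    rw [ContinuousLinearMap.comp_apply, ContinuousLinearMap.comp_apply, ContinuousLinearMap.adjoint_inner_left,
      ContinuousLinearMap.adjoint_inner_left, real_inner_self_eq_norm_sq]
    have e1 : ⟪R (A h), R h⟫ = ∑ i, lam i * (R h i * R h i) := by
      rw [EuclideanSpace.inner_eq_star_dotProduct]
      simp only [dotProduct, star_trivial]
      refine Finset.sum_congr rfl fun i _ => ?_
      show R h i * R (A h) i = _
      rw [hRA]; ring
    have e2 : ‖R h‖ ^ 2 = ∑ i, R h i * R h i := by
      rw [EuclideanSpace.norm_eq, Real.sq_sqrt (Finset.sum_nonneg fun i _ => sq_nonneg _)]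
      refine Finset.sum_congr rfl fun i _ => ?_
      rw [Real.norm_eq_abs, sq_abs]; ring
    rw [e1, e2, Finset.mul_sum, Finset.mul_sum]
    constructor
    · exact Finset.sum_le_sum fun i _ => mul_le_mul_of_nonneg_right (hlo i) (mul_self_nonneg _)
    · exact Finset.sum_le_sum fun i _ => mul_le_mul_of_nonneg_right (hhi i) (mul_self_nonneg _)

/-! ### The eigenvalues of `DW(y*)` sum to `3γ` -/

/-- **Trace identity**: if `DW(y*) = γI + DV(y*)` has an eigenbasis with eigenvalues `λ i` and `div V = 0`, then
`∑ λ i = 3γ`. [cite: ConstantinIgnatovaVicol2026Putative, §3.4.1 (div V = 3γ, Jacobian e^{3γτ})] -/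
theorem sum_eigenvalues_eq_three_mul (hdiv : VectorCalculus.IsDivFree V) (ystar : EuclideanSpace ℝ (Fin 3))
    (b : Module.Basis (Fin 3) ℝ (EuclideanSpace ℝ (Fin 3))) (lam : Fin 3 → ℝ)
    (hA : ∀ i, (γ • ContinuousLinearMap.id ℝ (EuclideanSpace ℝ (Fin 3)) + fderiv ℝ V ystar) (b i) = lam i • b i) :
    ∑ i, lam i = 3 * γ := by
  set A : EuclideanSpace ℝ (Fin 3) →L[ℝ] EuclideanSpace ℝ (Fin 3) :=
    γ • ContinuousLinearMap.id ℝ (EuclideanSpace ℝ (Fin 3)) + fderiv ℝ V ystar with hAdef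
  -- the trace of `A` in the eigenbasis
  have htr1 : LinearMap.trace ℝ _ (A : EuclideanSpace ℝ (Fin 3) →ₗ[ℝ] EuclideanSpace ℝ (Fin 3)) = ∑ i, lam i := by
    rw [LinearMap.trace_eq_matrix_trace ℝ b, Matrix.trace]
    refine Finset.sum_congr rfl fun i _ => ?_
    rw [Matrix.diag_apply, LinearMap.toMatrix_apply, ContinuousLinearMap.coe_coe, hA i, map_smul,
      Finsupp.smul_apply, b.repr_self, Finsupp.single_eq_same, smul_eq_mul, mul_one]
  -- the trace of `A = γ id + DV(y*)` is `3γ + div V(y*) = 3γ`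
  have htr2 : LinearMap.trace ℝ _ (A : EuclideanSpace ℝ (Fin 3) →ₗ[ℝ] EuclideanSpace ℝ (Fin 3)) = 3 * γ := by
    have hd : LinearMap.trace ℝ _ (fderiv ℝ V ystar : EuclideanSpace ℝ (Fin 3) →ₗ[ℝ] EuclideanSpace ℝ (Fin 3)) = 0 :=
      hdiv ystar
    rw [hAdef, ContinuousLinearMap.toLinearMap_add, ContinuousLinearMap.toLinearMap_smul, map_add, map_smul, hd,
      add_zero,
      ContinuousLinearMap.coe_id, LinearMap.trace_id, finrank_euclideanSpace, Fintype.card_fin, smul_eq_mul]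
    push_cast
    ring
  rw [← htr1, htr2]

/-! ### The node theorem for real-diagonalisable sources -/

/-- **VORTICITY VANISHES NEAR EVERY REAL-DIAGONALISABLE SOURCE, unconditionally in the window.**  Let `(V, P)` be a
classical self-similar profile (`V` smooth, `‖DV‖ ≤ K`) with `0 < γ < ½`, and `y*` a zero of `W = γy + V` at which
`DW(y*) = γI + DV(y*)` has a basis of eigenvectors with POSITIVE real eigenvalues.  Then `curl V ≡ 0` on a
neighbourhood of `y*`.  (By `div V = 0` the eigenvalues sum to `3γ`, so each is `< 3γ < 1 + γ`; the adapted inner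
product of the eigenbasis pinches `DW(y*)` in `[min λ, max λ] ⊂ (0, 1+γ)`, and `curl_eq_zero_near_adaptedSourceNode`
applies.) [cite: ConstantinIgnatovaVicol2026Putative, §3.5 Thm 3.8 (strengthened: any sign of Ω(y*), no outgoing
hypothesis, vanishing NEAR the node)] -/
theorem curl_eq_zero_near_diagonalisableSource (hV : ContDiff ℝ ∞ V) {K : ℝ} (hK : ∀ y, ‖fderiv ℝ V y‖ ≤ K)
    (hprof : IsSelfSimilarEulerProfile γ 0 V P) (hγ2 : γ < 1 / 2)
    {ystar : EuclideanSpace ℝ (Fin 3)} (hstar : selfSimilarTransport γ 0 V ystar = 0)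
    (b : Module.Basis (Fin 3) ℝ (EuclideanSpace ℝ (Fin 3))) (lam : Fin 3 → ℝ)
    (hA : ∀ i, (γ • ContinuousLinearMap.id ℝ (EuclideanSpace ℝ (Fin 3)) + fderiv ℝ V ystar) (b i) = lam i • b i)
    (hpos : ∀ i, 0 < lam i) :
    ∃ ρ : ℝ, 0 < ρ ∧ ∀ y : EuclideanSpace ℝ (Fin 3), ‖y - ystar‖ < ρ → curl V y = 0 := by
  -- eigenvalue bounds: `μ₀ = min`, `Λ₀ = max < 3γ < 1 + γ`
  have hsum := sum_eigenvalues_eq_three_mul (γ := γ) hprof.divFree ystar b lam hA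
  set μ₀ : ℝ := min (lam 0) (min (lam 1) (lam 2)) with hμ₀
  set Λ₀ : ℝ := max (lam 0) (max (lam 1) (lam 2)) with hΛ₀
  have hμ₀pos : 0 < μ₀ := lt_min (hpos 0) (lt_min (hpos 1) (hpos 2))
  have hlo : ∀ i, μ₀ ≤ lam i := by
    intro i; fin_cases i
    · exact min_le_left _ _
    · exact (min_le_right _ _).trans (min_le_left _ _)
    · exact (min_le_right _ _).trans (min_le_right _ _)
  have hhi : ∀ i, lam i ≤ Λ₀ := by
    intro i; fin_cases i
    · exact le_max_left _ _
    · exact (le_max_left _ _).trans (le_max_right _ _)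
    · exact (le_max_right _ _).trans (le_max_right _ _)
  have hΛ₀lt : Λ₀ < 1 + γ := by
    have h3 : ∑ i, lam i = lam 0 + lam 1 + lam 2 := by
      rw [Fin.sum_univ_three]
    rw [h3] at hsum
    have h0 := hpos 0; have h1 := hpos 1; have h2 := hpos 2
    have : Λ₀ < 3 * γ := by
      rw [hΛ₀]
      refine max_lt (by linarith) (max_lt (by linarith) (by linarith))
    linarith
  -- adapted inner product
  obtain ⟨G, hGsym, ⟨g₀, hg₀, hGpos⟩, hpinch⟩ :=
    exists_adapted_of_eigenbasis (γ • ContinuousLinearMap.id ℝ (EuclideanSpace ℝ (Fin 3)) + fderiv ℝ V ystar)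
      b lam hA hlo hhi
  have hnode : ∀ h : EuclideanSpace ℝ (Fin 3), μ₀ * ⟪G h, h⟫ ≤ ⟪G (γ • h + fderiv ℝ V ystar h), h⟫ ∧
      ⟪G (γ • h + fderiv ℝ V ystar h), h⟫ ≤ Λ₀ * ⟪G h, h⟫ := by
    intro h
    have := hpinch h
    simpa [_root_.add_apply, _root_.smul_apply, ContinuousLinearMap.id_apply] using this
  obtain ⟨r, hr, hzero⟩ := curl_eq_zero_near_adaptedSourceNode hV hK hprof hstar hGsym hg₀ hGpos hμ₀pos hΛ₀lt hnode
  -- a Euclidean ball inside the `G`-ball: `⟪G h, h⟫ ≤ ‖G‖ ‖h‖² < r²` for `‖h‖ < r / √(‖G‖ + 1)`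
  have hGn : 0 < ‖G‖ + 1 := by positivity
  refine ⟨r / Real.sqrt (‖G‖ + 1), by positivity, fun y hy => hzero y ?_⟩
  have h1 : ⟪G (y - ystar), y - ystar⟫ ≤ (‖G‖ + 1) * ‖y - ystar‖ ^ 2 := by
    calc ⟪G (y - ystar), y - ystar⟫ ≤ ‖G (y - ystar)‖ * ‖y - ystar‖ := real_inner_le_norm _ _
      _ ≤ ‖G‖ * ‖y - ystar‖ * ‖y - ystar‖ := mul_le_mul_of_nonneg_right (G.le_opNorm _) (norm_nonneg _)
      _ ≤ (‖G‖ + 1) * ‖y - ystar‖ ^ 2 := by nlinarith [norm_nonneg (y - ystar), norm_nonneg G]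
  have h2 : ‖y - ystar‖ * Real.sqrt (‖G‖ + 1) < r := by
    rwa [lt_div_iff₀ (Real.sqrt_pos.2 hGn)] at hy
  have h3 : (‖G‖ + 1) * ‖y - ystar‖ ^ 2 < r ^ 2 := by
    have h4 : (‖y - ystar‖ * Real.sqrt (‖G‖ + 1)) ^ 2 < r ^ 2 :=
      pow_lt_pow_left₀ h2 (by positivity) two_ne_zero
    rw [mul_pow, Real.sq_sqrt hGn.le] at h4
    linarith
  exact lt_of_le_of_lt h1 h3

end Summit.NavierStokesRegularity.NavierStokesRegularity.Theorems.PowerGaugeEulerLiouville.Kelvin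

end
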